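import Mathlib
import Literature.Computability.AlgebraicComplexity.NewtonPolygonTauBounds

/-!
# Crux `NewtonTauWeak` (stmt-ValiantsHypothesis-5904), line `slope-ladder`: three-parameter RIDGE families at `r = 4`
have at most `96 n^{7/3}` points — the source (and the cap) of the exponent `7/3`

A *ridge family* for four summands with three free parameters indexes the points of the sum by `t ∈ T ⊆ [n]³` and lets
the four summands depend on `t₀`, `t₁`, `t₂` and `t₀+t₁+t₂` respectively:
`s(t) = f₁(t₀) + f₂(t₁) + f₃(t₂) + f₄(t₀+t₁+t₂)`, so `s(T) ⊆ P₁+P₂+P₃+P₄` with `P₁ = f₁([n])`, …, `P₄ = f₄([3n])` of sizes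
`O(n)` (the Lagrange mechanism, the card's §5 "cubic lifts with translation classes", every "digit / class" construction of
the census are ridge families; v3 (a) treated full boxes `T = [n]^k`).  `ridge_three_le`: if `s` is injective on `T` and
`s(T)` is convexly independent then `#T ≤ 96 · n^{7/3}` — for EVERY index set `T`.  Proof: slice by `m = t₀ + t₁`; on a
slice `s(t) = [f₁(t₀) + f₂(m - t₀)] + [f₃(t₂) + f₄(m + t₂)]` is a point of a TWO-fold sum of `n`-sets, so the slice has
`≤ 16(n^{4/3} + 2n) ≤ 48 n^{4/3}` points by the in-tree Eisenbrand–Pach–Rothvoß–Sopher bound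
(`KPTT.EPRS.card_le_of_convexIndependent_subset_add`), and there are `≤ 2n` slices.

Census role (`Cruxes/NewtonTauWeak/CENSUS-stub_blockConvexBound-valwidth-p1-g2.md`, (w)): the conjectural value `7/3` for
`M_4(N)` in census v3 is exactly the cap of this ansatz, not evidence; and no three-parameter family can reach the
Eisenbrand–Pach–Rothvoß–Sopher exponent `8/3`, so none can FALSIFY `stub_blockConvexBound` at `r = 4` (the card's cheapest
falsifier, §5, is such a family).  Helper for the crux item (`--supports`); nothing here bears on `NewtonTauWeak` or `VP ≠ VNP`.
-/

set_option linter.dupNamespace false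

namespace Summit.ValiantsHypothesis.ValiantsHypothesis.Theorems.NewtonFramesNewtonTauWeak.BlockConvexRidge

open scoped BigOperators Pointwise
open Literature.Computability.AlgebraicComplexity.KPTT.EPRS (card_le_of_convexIndependent_subset_add)

noncomputable section

/-- Real bookkeeping: `16 (n^{2/3} n^{2/3} + n + n) ≤ 48 n^{4/3}` for `n ≥ 1`. [folklore] -/
theorem eprs_balanced_le (n : ℕ) (hn : 1 ≤ n) :
    16 * ((n : ℝ) ^ ((2 : ℝ) / 3) * (n : ℝ) ^ ((2 : ℝ) / 3) + n + n) ≤ 48 * (n : ℝ) ^ ((4 : ℝ) / 3) := by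
  have hn1 : (1 : ℝ) ≤ n := by exact_mod_cast hn
  have hn0 : (0 : ℝ) < n := by linarith
  have hsq : (n : ℝ) ^ ((2 : ℝ) / 3) * (n : ℝ) ^ ((2 : ℝ) / 3) = (n : ℝ) ^ ((4 : ℝ) / 3) := by
    rw [← Real.rpow_add hn0]; norm_num
  have hle : (n : ℝ) ≤ (n : ℝ) ^ ((4 : ℝ) / 3) := by
    calc (n : ℝ) = (n : ℝ) ^ (1 : ℝ) := (Real.rpow_one _).symm
      _ ≤ (n : ℝ) ^ ((4 : ℝ) / 3) := Real.rpow_le_rpow_of_exponent_le hn1 (by norm_num)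
  rw [hsq]
  linarith

/-- **Three-parameter ridge families at `r = 4` have `≤ 96 n^{7/3}` points.**  For any `f₁ f₂ f₃ f₄ : ℕ → ℝ²`, any
`T ⊆ [n]³` and `s(t) = f₁(t₀) + f₂(t₁) + f₃(t₂) + f₄(t₀+t₁+t₂)`: if `s` is injective on `T` and `s(T)` is convexly
independent then `#T ≤ 96 · n^{7/3}`.  (Slices `t₀ + t₁ = m` are two-fold sums of `n`-sets: EPRS.) [this file] -/
theorem ridge_three_le (n : ℕ) (f₁ f₂ f₃ f₄ : ℕ → (Fin 2 → ℝ)) (T : Finset (ℕ × ℕ × ℕ))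
    (hT : ∀ t ∈ T, t.1 < n ∧ t.2.1 < n ∧ t.2.2 < n)
    (s : ℕ × ℕ × ℕ → (Fin 2 → ℝ))
    (hs : ∀ t, s t = f₁ t.1 + f₂ t.2.1 + f₃ t.2.2 + f₄ (t.1 + t.2.1 + t.2.2))
    (hinj : Set.InjOn s ↑T)
    (hci : ConvexIndependent ℝ (Subtype.val : ↥((T.image s : Finset (Fin 2 → ℝ)) : Set (Fin 2 → ℝ)) → (Fin 2 → ℝ))) :
    (T.card : ℝ) ≤ 96 * (n : ℝ) ^ ((7 : ℝ) / 3) := by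
  classical
  rcases Nat.eq_zero_or_pos n with hn0 | hnpos
  · -- n = 0: T is empty
    subst hn0
    have hT0 : T = ∅ := Finset.eq_empty_iff_forall_notMem.2 fun t ht => by have := (hT t ht).1; omega
    rw [hT0, Finset.card_empty, Nat.cast_zero]
    positivity
  -- slice by m = t₀ + t₁ ∈ [0, 2n)
  set g : ℕ × ℕ × ℕ → ℕ := fun t => t.1 + t.2.1 with hg
  have hmaps : ∀ t ∈ T, g t ∈ Finset.range (2 * n) := by
    intro t ht
    obtain ⟨h0, h1, _⟩ := hT t ht
    exact Finset.mem_range.2 (by simp only [hg]; omega)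
  have hfib := Finset.card_eq_sum_card_fiberwise hmaps
  -- each slice has ≤ 48 n^{4/3} points
  have hslice : ∀ m ∈ Finset.range (2 * n),
      (((T.filter fun t => g t = m).card : ℕ) : ℝ) ≤ 48 * (n : ℝ) ^ ((4 : ℝ) / 3) := by
    intro m _
    set Tm := T.filter fun t => g t = m with hTm
    set G : Finset (Fin 2 → ℝ) := (Finset.range n).image fun j => f₁ j + f₂ (m - j) with hG
    set F : Finset (Fin 2 → ℝ) := (Finset.range n).image fun i => f₃ i + f₄ (m + i) with hF
    set Sm : Finset (Fin 2 → ℝ) := Tm.image s with hSm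
    have hsub : Sm ⊆ G + F := by
      intro p hp
      obtain ⟨t, ht, rfl⟩ := Finset.mem_image.1 hp
      obtain ⟨htT, htm⟩ := Finset.mem_filter.1 ht
      obtain ⟨h0, h1, h2⟩ := hT t htT
      simp only [hg] at htm
      have e1 : t.2.1 = m - t.1 := by omega
      have e2 : t.1 + t.2.1 + t.2.2 = m + t.2.2 := by omega
      rw [hs t, e2]
      refine Finset.mem_add.2 ⟨f₁ t.1 + f₂ t.2.1, ?_, f₃ t.2.2 + f₄ (m + t.2.2), ?_, by abel⟩
      · exact Finset.mem_image.2 ⟨t.1, Finset.mem_range.2 h0, by rw [e1]⟩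
      · exact Finset.mem_image.2 ⟨t.2.2, Finset.mem_range.2 h2, rfl⟩
    have hciS : ConvexIndependent ℝ (Subtype.val : ↥((Sm : Set (Fin 2 → ℝ))) → (Fin 2 → ℝ)) := by
      refine hci.mono ?_
      intro p hp
      obtain ⟨t, ht, rfl⟩ := Finset.mem_image.1 (Finset.mem_coe.1 hp)
      exact Finset.mem_coe.2 (Finset.mem_image.2 ⟨t, (Finset.mem_filter.1 ht).1, rfl⟩)
    have hE := card_le_of_convexIndependent_subset_add G F Sm hsub hciS
    have hGc : (G.card : ℝ) ≤ n := by
      exact_mod_cast (Finset.card_image_le.trans (by simp))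
    have hFc : (F.card : ℝ) ≤ n := by
      exact_mod_cast (Finset.card_image_le.trans (by simp))
    have hG0 : (0 : ℝ) ≤ G.card := Nat.cast_nonneg _
    have hF0 : (0 : ℝ) ≤ F.card := Nat.cast_nonneg _
    have hprod : (G.card : ℝ) ^ ((2 : ℝ) / 3) * (F.card : ℝ) ^ ((2 : ℝ) / 3)
        ≤ (n : ℝ) ^ ((2 : ℝ) / 3) * (n : ℝ) ^ ((2 : ℝ) / 3) :=
      mul_le_mul (Real.rpow_le_rpow hG0 hGc (by norm_num)) (Real.rpow_le_rpow hF0 hFc (by norm_num))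
        (by positivity) (by positivity)
    have hcardTm : Tm.card = Sm.card := by
      rw [hSm, Finset.card_image_of_injOn (hinj.mono (by
        intro t ht; exact Finset.mem_coe.2 (Finset.mem_filter.1 (Finset.mem_coe.1 ht)).1))]
    rw [hcardTm]
    calc (Sm.card : ℝ) ≤ 16 * ((G.card : ℝ) ^ ((2 : ℝ) / 3) * (F.card : ℝ) ^ ((2 : ℝ) / 3) + G.card + F.card) := hE
      _ ≤ 16 * ((n : ℝ) ^ ((2 : ℝ) / 3) * (n : ℝ) ^ ((2 : ℝ) / 3) + n + n) := by gcongr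
      _ ≤ 48 * (n : ℝ) ^ ((4 : ℝ) / 3) := eprs_balanced_le n hnpos
  -- sum over the 2n slices
  have hsum : (T.card : ℝ) ≤ ∑ m ∈ Finset.range (2 * n), (48 : ℝ) * (n : ℝ) ^ ((4 : ℝ) / 3) := by
    rw [hfib]
    push_cast
    exact Finset.sum_le_sum hslice
  rw [Finset.sum_const, Finset.card_range, nsmul_eq_mul] at hsum
  have hn0 : (0 : ℝ) < n := by exact_mod_cast hnpos
  have hpow : (n : ℝ) * (n : ℝ) ^ ((4 : ℝ) / 3) = (n : ℝ) ^ ((7 : ℝ) / 3) := by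
    have h := Real.rpow_add hn0 (1 : ℝ) ((4 : ℝ) / 3)
    rw [Real.rpow_one] at h
    rw [← h]
    norm_num
  calc (T.card : ℝ) ≤ ((2 * n : ℕ) : ℝ) * (48 * (n : ℝ) ^ ((4 : ℝ) / 3)) := hsum
    _ = 96 * ((n : ℝ) * (n : ℝ) ^ ((4 : ℝ) / 3)) := by push_cast; ring
    _ = 96 * (n : ℝ) ^ ((7 : ℝ) / 3) := by rw [hpow]

end

end Summit.ValiantsHypothesis.ValiantsHypothesis.Theorems.NewtonFramesNewtonTauWeak.BlockConvexRidge
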